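import Mathlib

/-!
# SoloBlindNetBaseLocus — the base locus of a coordinate net sees only the complementary partials

solo-HodgeConjecture-blind, session s10 (referee item N3 for the net criterion, Theorem N;
`paper/net-criterion-details.md` §I, Lemma I.1).

Let `F` be a polynomial in variables indexed by `σ`, `I` a finite set of indices and
`Π_I = {x : x i = 0 for i ∈ I}` the coordinate subspace.  If NO monomial of `F` has total degree
exactly `1` in the variables of `I` (its `I`-degree), then for every `i ∈ I` the partial derivative
`∂F/∂xᵢ` vanishes identically on `Π_I`.  Hence the Jacobian ideal of the hypersurface `X = {F = 0}`
restricted to `Π_I` is generated by `F|_{Π_I}` and the partials in the complementary variables, which are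
the partials of `F|_{Π_I}`: `Sing(X ∩ Π_I) = Sing(X) ∩ Π_I`.  For a smooth member of a torus-symmetric
family whose monomial set has no monomial of `I`-degree one, the base curve of the net `x ↦ (xᵢ)_{i∈I}`
is therefore smooth and the blow-up `Bl_Γ X` needs no resolution (this is the case for the family `F1`
and for 482 of the 487 net-covered blocks of the census; see the paper).

Only the algebraic identity is formalised here; it holds over any commutative semiring.
-/

namespace Summit.HodgeConjecture.HodgeConjecture.Theorems

open MvPolynomial

variable {σ R : Type*} [CommSemiring R]

/-- The `I`-degree of an exponent vector `a`: the total degree in the variables indexed by `I`. -/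
def netIDegree (I : Finset σ) (a : σ →₀ ℕ) : ℕ := ∑ i ∈ I, a i

/-- Splitting off one index of `I` from the `I`-degree. -/
theorem netIDegree_eq_add_erase [DecidableEq σ] (I : Finset σ) (a : σ →₀ ℕ) {i : σ} (hi : i ∈ I) :
    netIDegree I a = a i + ∑ j ∈ I.erase i, a j := by
  unfold netIDegree
  exact (Finset.add_sum_erase I (fun j => a j) hi).symm

/-- A single monomial of `I`-degree `≠ 1`: its `xᵢ`-partial (`i ∈ I`) vanishes at every point of `Π_I`. -/
theorem eval_pderiv_monomial_eq_zero_of_netIDegree_ne_one (I : Finset σ) (a : σ →₀ ℕ) (c : R)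
    (ha : netIDegree I a ≠ 1) (p : σ → R) (hp : ∀ j ∈ I, p j = 0) {i : σ} (hi : i ∈ I) :
    eval p (pderiv i (monomial a c)) = 0 := by
  classical
  rw [pderiv_monomial, eval_monomial]
  by_cases h0 : a i = 0
  · simp [h0]
  · -- some index `j ∈ I` keeps a positive exponent in `a - single i 1`
    have key : ∃ j ∈ I, (a - Finsupp.single i 1 : σ →₀ ℕ) j ≠ 0 := by
      by_cases h1 : a i = 1
      · have hne : ∑ j ∈ I.erase i, a j ≠ 0 := by
          intro hs
          apply ha
          rw [netIDegree_eq_add_erase I a hi, h1, hs]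
        obtain ⟨j, hj, hj0⟩ := Finset.exists_ne_zero_of_sum_ne_zero hne
        refine ⟨j, Finset.mem_of_mem_erase hj, ?_⟩
        have hji : j ≠ i := Finset.ne_of_mem_erase hj
        rw [Finsupp.tsub_apply, Finsupp.single_apply, if_neg hji.symm, tsub_zero]
        exact hj0
      · refine ⟨i, hi, ?_⟩
        rw [Finsupp.tsub_apply, Finsupp.single_apply, if_pos rfl]
        omega
    obtain ⟨j, hjI, hj⟩ := key
    have hmem : j ∈ (a - Finsupp.single i 1).support := Finsupp.mem_support_iff.mpr hj
    rw [Finsupp.prod, Finset.prod_eq_zero hmem (by rw [hp j hjI, zero_pow hj]), mul_zero]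

/-- **Lemma I.1 (kernel form).**  If no monomial of `F` has `I`-degree exactly one, then for every
`i ∈ I` the partial derivative `∂F/∂xᵢ` vanishes at every point whose `I`-coordinates are zero. -/
theorem eval_pderiv_eq_zero_of_netIDegree_ne_one (I : Finset σ) (F : MvPolynomial σ R)
    (hF : ∀ a ∈ F.support, netIDegree I a ≠ 1) (p : σ → R) (hp : ∀ j ∈ I, p j = 0)
    {i : σ} (hi : i ∈ I) : eval p (pderiv i F) = 0 := by
  classical
  conv_lhs => rw [F.as_sum]
  rw [map_sum, map_sum]
  exact Finset.sum_eq_zero fun a ha =>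
    eval_pderiv_monomial_eq_zero_of_netIDegree_ne_one I a _ (hF a ha) p hp hi

/-- The same statement with the hypothesis on coefficients instead of the support. -/
theorem eval_pderiv_eq_zero_of_coeff (I : Finset σ) (F : MvPolynomial σ R)
    (hF : ∀ a, coeff a F ≠ 0 → netIDegree I a ≠ 1) (p : σ → R) (hp : ∀ j ∈ I, p j = 0)
    {i : σ} (hi : i ∈ I) : eval p (pderiv i F) = 0 :=
  eval_pderiv_eq_zero_of_netIDegree_ne_one I F (fun a ha => hF a (mem_support_iff.mp ha)) p hp hi

end Summit.HodgeConjecture.HodgeConjecture.Theorems
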